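import Mathlib

/-!
# Joint quasimode pigeonhole (abstract Hilbert-space form)

Stub `stub_jointQuasimodePigeonhole` for line *Sketch* of the crux
`Summit.Langlands.Langlands.Theses.QuarterDeficit1951.QuarterFingerprintDeficit`.

Informal statement (Booker–Strömbergsson–Venkatesh 2006, Lemma 3.2, with the commuting operators
abstracted away): let `b` be a Hilbert basis of a complex Hilbert space `E`, `f ≠ 0` a trial
vector, and for finitely many labels `v ∈ s` let `g v : E` be vectors whose `b`-coefficients are
`(μ v i - t v) * b.repr f i` (in the application `g v = (T_v - t_v) f` for an operator `T_v`
diagonal in `b` with eigenvalues `μ v i`), with `‖g v‖ ≤ ε v * ‖f‖`. Then some basis vector `b i`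
occurring in `f` (`b.repr f i ≠ 0`) has all its "eigenvalues" in the boxes
`‖μ v i - t v‖ ≤ √#s * ε v`.

Proof: Parseval gives `∑ i, ‖b.repr f i‖² ‖μ v i - t v‖² = ‖g v‖² ≤ (ε v)² ‖f‖²`; dividing by
`(ε v)²`, summing over `v ∈ s` and comparing with `∑ i, ‖b.repr f i‖² = ‖f‖²` (a weighted
pigeonhole, Mathlib's `hasSum_lt`) produces an index `i` of positive weight with
`∑ v ∈ s, ‖μ v i - t v‖² / (ε v)² ≤ #s`, whence each box inequality.

Only Mathlib is used (`HilbertBasis.hasSum_inner_mul_inner`, `hasSum_sum`, `hasSum_lt`).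
Deliberately NOT here: the operators `T_v`, their symmetry/commutation, or any Maass-form
specifics; those enter only through the coefficient hypothesis `hg`.
-/

set_option linter.dupNamespace false

namespace Summit.Langlands.Langlands.Theorems.QuarterFingerprintDeficit

open scoped InnerProductSpace

/-- Parseval's identity in norm-square form for a Hilbert basis `b` of an inner product space `E`
over `𝕜 = ℝ` or `ℂ`: `∑ i, ‖(b.repr x) i‖² = ‖x‖²` as a `HasSum` statement (Mathlib's
`HilbertBasis.hasSum_inner_mul_inner` with `y = x`, real parts). [folklore] -/
private theorem hasSum_norm_repr_sq {𝕜 ι E : Type*} [RCLike 𝕜] [NormedAddCommGroup E]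
    [InnerProductSpace 𝕜 E] (b : HilbertBasis ι 𝕜 E) (x : E) :
    HasSum (fun i => ‖b.repr x i‖ ^ 2) (‖x‖ ^ 2) := by
  have h := (b.hasSum_inner_mul_inner x x).map RCLike.re RCLike.continuous_re
  rw [← inner_self_eq_norm_sq (𝕜 := 𝕜)]
  convert h using 1
  funext i
  simp only [Function.comp_apply]
  rw [HilbertBasis.repr_apply_apply, ← inner_conj_symm x (b i), RCLike.conj_mul,
    ← RCLike.ofReal_pow, RCLike.ofReal_re]

/-- **Joint quasimode pigeonhole** (Booker–Strömbergsson–Venkatesh 2006, Lemma 3.2, abstract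
form). Let `b` be a Hilbert basis of the complex Hilbert space `E`, `f ≠ 0`, `s` a finite set of
labels, and for `v ∈ s` let `g v : E` have `b`-coefficients `(μ v i - t v) * b.repr f i` and norm
`‖g v‖ ≤ ε v * ‖f‖`, where `ε v > 0`. Then there is an index `i` with `b.repr f i ≠ 0` such that
`‖μ v i - t v‖ ≤ √#s * ε v` for every `v ∈ s`. (In the application `g v = (T_v - t_v) f` for
commuting symmetric operators `T_v` diagonal in `b`, so `b i` is a true joint eigenvector whose
eigenvalues lie in the boxes around the approximate joint eigenvalue `t`.)
[cite: BookerStrombergssonVenkatesh2006, Lemma 3.2] -/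
theorem stub_jointQuasimodePigeonhole {ι E V : Type*} [NormedAddCommGroup E]
    [InnerProductSpace ℂ E] [CompleteSpace E] (b : HilbertBasis ι ℂ E) (f : E) (hf : f ≠ 0)
    (s : Finset V) (g : V → E) (μ : V → ι → ℂ) (t : V → ℂ) (ε : V → ℝ)
    (hε : ∀ v ∈ s, 0 < ε v)
    (hg : ∀ v ∈ s, ∀ i, b.repr (g v) i = (μ v i - t v) * b.repr f i)
    (hbound : ∀ v ∈ s, ‖g v‖ ≤ ε v * ‖f‖) :
    ∃ i, b.repr f i ≠ 0 ∧ ∀ v ∈ s, ‖μ v i - t v‖ ≤ Real.sqrt s.card * ε v := by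
  -- Parseval for `f`: the weights `‖b.repr f i‖²` sum to `‖f‖²`.
  have hcf : HasSum (fun i => ‖b.repr f i‖ ^ 2) (‖f‖ ^ 2) := hasSum_norm_repr_sq b f
  -- Parseval for `g v`, rewritten through `hg` and divided by `(ε v)²`.
  have hv : ∀ v ∈ s, HasSum (fun i => ‖b.repr f i‖ ^ 2 * (‖μ v i - t v‖ ^ 2 / ε v ^ 2))
      (‖g v‖ ^ 2 / ε v ^ 2) := by
    intro v hv
    have heq : (fun i => ‖b.repr f i‖ ^ 2 * (‖μ v i - t v‖ ^ 2 / ε v ^ 2)) =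
        fun i => ‖b.repr (g v) i‖ ^ 2 / ε v ^ 2 := by
      funext i
      rw [hg v hv i, norm_mul, mul_pow]
      ring
    rw [heq]
    exact (hasSum_norm_repr_sq b (g v)).div_const (ε v ^ 2)
  -- Summing over `v ∈ s`.
  have hD : HasSum (fun i => ‖b.repr f i‖ ^ 2 * ∑ v ∈ s, ‖μ v i - t v‖ ^ 2 / ε v ^ 2)
      (∑ v ∈ s, ‖g v‖ ^ 2 / ε v ^ 2) := by
    simpa only [Finset.mul_sum] using hasSum_sum hv
  -- The total is at most `#s * ‖f‖²`.
  have hbd : ∑ v ∈ s, ‖g v‖ ^ 2 / ε v ^ 2 ≤ s.card * ‖f‖ ^ 2 := by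
    have h1 : ∀ v ∈ s, ‖g v‖ ^ 2 / ε v ^ 2 ≤ ‖f‖ ^ 2 := by
      intro v hv
      have hεv := hε v hv
      rw [div_le_iff₀ (by positivity)]
      calc ‖g v‖ ^ 2 ≤ (ε v * ‖f‖) ^ 2 := pow_le_pow_left₀ (norm_nonneg _) (hbound v hv) 2
        _ = ‖f‖ ^ 2 * ε v ^ 2 := by ring
    calc ∑ v ∈ s, ‖g v‖ ^ 2 / ε v ^ 2 ≤ ∑ v ∈ s, ‖f‖ ^ 2 := Finset.sum_le_sum h1
      _ = s.card * ‖f‖ ^ 2 := by rw [Finset.sum_const, nsmul_eq_mul]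
  -- Some coefficient of `f` is nonzero, since `f ≠ 0`.
  obtain ⟨i₀, hi₀⟩ : ∃ i, b.repr f i ≠ 0 := by
    by_contra h
    push Not at h
    have h0 : (fun i => ‖b.repr f i‖ ^ 2) = fun _ => (0 : ℝ) := funext fun i => by simp [h i]
    rw [h0] at hcf
    have hnorm : ‖f‖ ^ 2 = 0 := hcf.unique hasSum_zero
    exact hf (norm_eq_zero.mp ((pow_eq_zero_iff two_ne_zero).mp hnorm))
  -- Weighted pigeonhole, by contradiction.
  by_contra hcon
  push Not at hcon
  have hlt : ∀ i, b.repr f i ≠ 0 →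
      (s.card : ℝ) < ∑ v ∈ s, ‖μ v i - t v‖ ^ 2 / ε v ^ 2 := by
    intro i hi
    obtain ⟨v, hv, hvi⟩ := hcon i hi
    have hεv := hε v hv
    have h1 : (s.card : ℝ) < ‖μ v i - t v‖ ^ 2 / ε v ^ 2 := by
      rw [lt_div_iff₀ (by positivity)]
      have h2 : (0 : ℝ) ≤ Real.sqrt s.card * ε v := by positivity
      calc (s.card : ℝ) * ε v ^ 2 = (Real.sqrt s.card * ε v) ^ 2 := by
            rw [mul_pow, Real.sq_sqrt (Nat.cast_nonneg _)]
        _ < ‖μ v i - t v‖ ^ 2 := pow_lt_pow_left₀ hvi h2 two_ne_zero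
    calc (s.card : ℝ) < ‖μ v i - t v‖ ^ 2 / ε v ^ 2 := h1
      _ ≤ ∑ w ∈ s, ‖μ w i - t w‖ ^ 2 / ε w ^ 2 :=
        Finset.single_le_sum (f := fun w => ‖μ w i - t w‖ ^ 2 / ε w ^ 2)
          (fun w _ => by positivity) hv
  have hle : ∀ i, ‖b.repr f i‖ ^ 2 * (s.card : ℝ) ≤
      ‖b.repr f i‖ ^ 2 * ∑ v ∈ s, ‖μ v i - t v‖ ^ 2 / ε v ^ 2 := by
    intro i
    by_cases hi : b.repr f i = 0
    · simp [hi]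
    · exact mul_le_mul_of_nonneg_left (hlt i hi).le (sq_nonneg _)
  have hi₀' : ‖b.repr f i₀‖ ^ 2 * (s.card : ℝ) <
      ‖b.repr f i₀‖ ^ 2 * ∑ v ∈ s, ‖μ v i₀ - t v‖ ^ 2 / ε v ^ 2 :=
    mul_lt_mul_of_pos_left (hlt i₀ hi₀) (pow_pos (norm_pos_iff.mpr hi₀) 2)
  have key := hasSum_lt (f := fun i => ‖b.repr f i‖ ^ 2 * (s.card : ℝ))
    (g := fun i => ‖b.repr f i‖ ^ 2 * ∑ v ∈ s, ‖μ v i - t v‖ ^ 2 / ε v ^ 2)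
    hle hi₀' (hcf.mul_right _) hD
  have habs : (s.card : ℝ) * ‖f‖ ^ 2 < s.card * ‖f‖ ^ 2 :=
    calc (s.card : ℝ) * ‖f‖ ^ 2 = ‖f‖ ^ 2 * s.card := mul_comm _ _
      _ < ∑ v ∈ s, ‖g v‖ ^ 2 / ε v ^ 2 := key
      _ ≤ s.card * ‖f‖ ^ 2 := hbd
  exact lt_irrefl _ habs

end Summit.Langlands.Langlands.Theorems.QuarterFingerprintDeficit
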